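import Summits.ABC.IUTFork.Repair.CandJoshi22
import HarnessLib

/-!
# IUT REPAIR BRANCH (LADDER-ABC:A2.RP), class (iii) JOSHI, j2 — the VALUE-CHART SCALING MODEL for door (a): Joshi's valuation law
# `v_{K_j} = j²·v_{K_1}` typed ℚ-LINEARLY on the value line (regions = order half-lines; the unit shell is scale-INVARIANT)

Record file of the abc-iut cell's IUT REPAIR BRANCH (seat abc-iut-rp-j2, gen 2; row RP-J05 door (a); sequel to `Repair/CandJoshi21` p427435,
`CandJoshi22` p431543, `CandJoshi22Tests` p432807). TAKES NO SIDE on [IUTchIII] Cor. 3.12 or on any author. MODEL DATA only (toy, over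
abc-iut-c312-7's one-place `toyIndex`, `l⋇ = 2`); no `Prop` fact; nothing about the intended objects of [IUTchIII] or of K. Joshi's theory is
asserted; typed ≠ proved ≠ endorsed.

THE REPAIR-CENSUS ITEM. `CandJoshi22Tests` priced door (a) (H_J21-2 `JoshiScalingIndeterminacy` / H_J21-5 `JoshiNonIsometricIndeterminacy`:
«⟨(Ind1) ∪ (Ind2)⟩ contains the Θ_gau-link's valuation scaling», arXiv:2106.11452 Thm. (th:main3); arXiv:2303.01662 Thm. 6.9.1 (3)(4), Rmk.
6.10.4, §8.2.1, Rmk. 8.5.2) on abc-iut-w4-d098's SCALING SHELLS, where the move is a `p`-adic HOMOTHETY of CONSTANT log-modulus, so that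
abc-iut-rp-s2's `ObstructionSS2.not_thetaFinite_of_rescaling` exhausts the packet: `−|log(Θ)| = +∞`; it left open «whether a NON-linear
realisation escapes this». Joshi's printed law is MULTIPLICATIVE ON VALUATIONS — 2303.01662 Thm. 6.9.1 (3) / (9.2.3) p. 27 «`v_{K_j}(p) =
j²·v_{K_1}(p)`» — i.e. ℚ-LINEAR ON THE VALUE LINE `ord(−) ⊗ ℚ`. This file hosts exactly that inside the frozen ℚ-linear interface:
§1 the VALUE CHART = w4-d098's `scalarShells p U`, `U :=` the POSITIVE rationals (carrier `ℚ` read as the value line; a scalar `u > 0` = the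
law `v ↦ u·v`), regions the ORDER half-lines `H_a := {x | a ≤ line x}` (`H_a` = chart of `q^a·𝒪`, `H_0` = the unit shell), log-volume
`μ(H_a) := −a·log p`; §2 data (a)(b)(c) `vData` (splitting monoid = the valuation tuple `(j²)_j` of the Θ-values), column (identity Kummer
transport), `vFull p`, **`vFull_statement`: the typed Thm. 3.11 (i) ∧ (ii) ∧ (iii) HOLDS**; §3 hull frame `vFrame` (hull-sets the half-lines)
and `valSetting p` (w4-d101's honest object side `pinSig`; HONEST glue `Θ ↦ H_{j²}`, `q ↦ H_1` on `𝔽_l^⋇`, `H_0` at the junk label — scale-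
invariant, so no empty-region device); §4 the reading `vRho` «`X ↦ {v ≥ X_j}`» (chart of w4-d101's `Ψ ↦ Ψ_j·𝒪`), EQUIVARIANT under all of
`⟨(Ind1) ∪ (Ind2)⟩` (w4-d098's `actsByScalars_of_mem_closure`, cited), **the THREE PINS** for the honest q-datum `vQDatum = (1)_j`. The
HONEST VOLUMES (`qLocal = −log p` label-independently, `|log(q)| > 0`, exact `j²`-scaling) and the tests (H_J21-2 by the single-factor move
`v ↦ v/4` at label `2`, H_J21-5, the residual, and the NEW PRICE SHEET: BridgeHyps ∧ ThetaFinite ∧ Statement HOLD, `−|log(Θ)| = 0` — the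
orbit of `H_4` accumulates at the invariant shell `H_0` —, Step (x) invariance the ONE failing ∀-form clause, NO constant modulus) are the sequel
`CandJoshi23Tests`. HONEST SCOPE: interface-level; NOT a model of initial Θ-data; the chart identifies a log-shell packet with its value line,
which [IUTchIII] does not do ((Ind1)/(Ind2) act on `log(𝒪^×) ⊗ ℚ` by isometries, Step (x) p. 181 l. 5–13); the model prices Joshi's law as
printed, it does not read [IUTchIII]. [claim: Mochizuki2012, status: disputed] [claim: Joshi2023ATS2Local, status: disputed]
-/


noncomputable section

open Set

namespace Summit.ABC.IUTFork.Repair.CandJoshi23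

open Thm311 Cor312 Cor312.Checks Cor312.IdentifiedNonVacuity Cor312Vol Cor312Vol.NaiveWitness Cor312Vol.PinnedWitness
  Literature.IUT.LogThetaLattice Summit.ABC.IUTFork.Repair Summit.ABC.IUTFork.Repair.ScalarShells
  Summit.ABC.IUTFork.Repair.ScalarShellsThm311

variable (p : ℕ)

/-! ## 1. The value chart: positive scalars, order half-lines, their log-volume -/

/-- The scalar group of the value chart: the POSITIVE rationals (a scalar `u` = the valuation law `v ↦ u·v`; Joshi's `j²`, and their
quotients, are positive). [claim: Joshi2023ATS2Local, status: disputed] -/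
abbrev posScalars : Subgroup ℚˣ := Units.posSubgroup ℚ

/-- **The VALUE-CHART shells**: abc-iut-w4-d098's scalar shells over the positive rationals — carrier `ℚ` READ AS THE VALUE LINE
`ord(−) ⊗ ℚ` of a bad place, strip-automorphisms and "Ism" the positive scalings (the `shell` slot of the structure is read by no clause
below; the model's integral structure is `vData.shellPk = H_0`). [claim: Joshi2023ATS2Local, status: disputed] -/
abbrev valShells : LogShells toyIndex := scalarShells p posScalars

/-- The ORDER HALF-LINE `H_a := {x | a ≤ line x}` of the packet line at `(j, v_ℚ)` — the value chart of the ball `q^a·𝒪`. [folklore] -/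
def vHalf (j : toyIndex.Label) (vQ : toyIndex.VQ) (a : ℚ) : Set ((valShells p).Packet j vQ) := {x | a ≤ line j vQ x}

variable {p} in
/-- Membership in a half-line. [folklore] -/
theorem mem_vHalf {j : toyIndex.Label} {vQ : toyIndex.VQ} {a : ℚ} {x : (valShells p).Packet j vQ} :
    x ∈ vHalf p j vQ a ↔ a ≤ line j vQ x := Iff.rfl

/-- The point of the packet line with coordinate `a`. [folklore] -/
def pt (j : toyIndex.Label) (vQ : toyIndex.VQ) (a : ℚ) : (valShells p).Packet j vQ := (line j vQ).symm a

/-- Its coordinate is `a`. [folklore] -/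
theorem line_pt (j : toyIndex.Label) (vQ : toyIndex.VQ) (a : ℚ) : line j vQ (pt p j vQ a) = a :=
  LinearEquiv.apply_symm_apply _ _

/-- `pt a ∈ H_a`. [folklore] -/
theorem pt_mem_vHalf (j : toyIndex.Label) (vQ : toyIndex.VQ) (a : ℚ) : pt p j vQ a ∈ vHalf p j vQ a := by
  rw [mem_vHalf, line_pt]

/-- Half-lines are ANTITONE in the threshold: `a ≤ b ⟹ H_b ⊆ H_a`. [folklore] -/
theorem vHalf_anti {j : toyIndex.Label} {vQ : toyIndex.VQ} {a b : ℚ} (h : a ≤ b) : vHalf p j vQ b ⊆ vHalf p j vQ a :=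
  fun _ hx => le_trans h hx

/-- … and conversely: `H_b ⊆ H_a ⟹ a ≤ b`. [folklore] -/
theorem le_of_vHalf_subset {j : toyIndex.Label} {vQ : toyIndex.VQ} {a b : ℚ} (h : vHalf p j vQ b ⊆ vHalf p j vQ a) : a ≤ b := by
  have hb := h (pt_mem_vHalf p j vQ b)
  rwa [mem_vHalf, line_pt] at hb

/-- `H_a = H_b ⟺ a = b`. [folklore] -/
theorem vHalf_eq_iff {j : toyIndex.Label} {vQ : toyIndex.VQ} {a b : ℚ} : vHalf p j vQ a = vHalf p j vQ b ↔ a = b :=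
  ⟨fun h => le_antisymm (le_of_vHalf_subset p h.symm.subset) (le_of_vHalf_subset p h.subset), fun h => h ▸ rfl⟩

open scoped Classical in
/-- **The log-volume of the value chart**: `μ(H_a) := −a·log p` (the `p`-adic log-volume of `q^a·𝒪`, `q := p`), `0` on non-half-lines
(never read). [claim: Mochizuki2012, status: disputed] -/
def vVol (j : toyIndex.Label) (vQ : toyIndex.VQ) (A : Set ((valShells p).Packet j vQ)) : ℝ :=
  if h : ∃ a : ℚ, A = vHalf p j vQ a then -((Classical.choose h : ℚ) : ℝ) * Real.log p else 0

/-- `μ(H_a) = −a·log p`. [folklore] -/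
theorem vVol_vHalf (j : toyIndex.Label) (vQ : toyIndex.VQ) (a : ℚ) : vVol p j vQ (vHalf p j vQ a) = -(a : ℝ) * Real.log p := by
  have h : ∃ b : ℚ, vHalf p j vQ a = vHalf p j vQ b := ⟨a, rfl⟩
  unfold vVol
  rw [dif_pos h, ← (vHalf_eq_iff p).1 (Classical.choose_spec h)]

/-- **SCALING TRANSPORT**: a packet automorphism acting on the line by a POSITIVE scalar `u` maps `H_a` ONTO `H_{u·a}` (the valuation law
`v ↦ u·v` applied to the ball `{v ≥ a}`). [folklore] -/
theorem image_vHalf_of_line_eq {j : toyIndex.Label} {vQ : toyIndex.VQ}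
    (Φ : (valShells p).Packet j vQ ≃ₗ[ℚ] (valShells p).Packet j vQ) {u : ℚ} (hu : 0 < u)
    (hΦ : ∀ x, line j vQ (Φ x) = u * line j vQ x) (a : ℚ) : Φ '' vHalf p j vQ a = vHalf p j vQ (u * a) := by
  apply Set.Subset.antisymm
  · rintro _ ⟨x, hx, rfl⟩
    rw [mem_vHalf, hΦ]
    exact mul_le_mul_of_nonneg_left hx hu.le
  · intro y hy
    refine ⟨Φ.symm y, ?_, LinearEquiv.apply_symm_apply _ _⟩
    have h1 := hΦ (Φ.symm y)
    rw [LinearEquiv.apply_symm_apply] at h1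
    rw [mem_vHalf, h1] at hy
    exact le_of_mul_le_mul_left hy hu

/-! ## 2. The data (a)(b)(c), the situation, the column, the full situation; the typed Theorem 3.11 holds -/

/-- **The Θ-side Kummer datum in the value chart**: the valuation tuple `(j²)_{j ∈ 𝔽_l^⋇}` of the Θ-values `q^{j²}` (one tuple; signs are
invisible to valuations). [claim: Mochizuki2012, status: disputed] -/
def vPsi (v : toyIndex.V) : Set ((valShells p).StarPacket v) :=
  {ψ | ∀ j : toyIndex.LabelStar, line j.1 (toyIndex.over v) (ψ j) = (jsq j.1 : ℚ)}

/-- **The q-pilot's Kummer datum in the value chart**: the valuation tuple `(1)_{j ∈ 𝔽_l^⋇}` of `q` (exponent `1` = the exponent of the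
setting's own q-pilot datum, `valSetting_qPilot`). [claim: Mochizuki2012, status: disputed] -/
def vQDatum : ∀ v : toyIndex.V, v ∈ toyIndex.Vbad → Set ((valShells p).StarPacket v) := fun v _ =>
  {ψ | ∀ j : toyIndex.LabelStar, line j.1 (toyIndex.over v) (ψ j) = 1}

/-- The Θ-tuple `(j²)_j` itself. [folklore] -/
def thetaTuple (vQ : toyIndex.VQ) : (valShells p).StarPacket vQ := fun j => pt p j.1 vQ (jsq j.1 : ℚ)

/-- It lies in `vPsi`. [folklore] -/
theorem thetaTuple_mem (vQ : toyIndex.VQ) : thetaTuple p vQ ∈ vPsi p vQ := fun j => line_pt p j.1 vQ _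

/-- The q-tuple `(1)_j` itself. [folklore] -/
def qTuple (vQ : toyIndex.VQ) : (valShells p).StarPacket vQ := fun j => pt p j.1 vQ 1

/-- It lies in `vQDatum`. [folklore] -/
theorem qTuple_mem (vQ : toyIndex.VQ) : qTuple p vQ ∈ vQDatum p vQ (Set.mem_univ _) := fun j => line_pt p j.1 vQ _

/-- **The data (a)(b)(c) of every vertical line in the value chart** ([IUTchIII] Thm. 3.11 (i)): integral structures the unit shell `H_0`,
admissible regions the half-lines, log-volume `μ(H_a) = −a·log p`, splitting monoid the Θ-tuple, number-field copy the global packet.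
[claim: Mochizuki2012, status: disputed] -/
def vData : MRData (valShells p) where
  shellPk := fun j vQ => vHalf p j vQ 0
  shellSub := fun j v => vHalf p j (toyIndex.over v) 0
  Adm := fun j vQ A => ∃ a : ℚ, A = vHalf p j vQ a
  logvol := fun j vQ A => vVol p j vQ A
  Ψ := fun v _ => vPsi p v
  act := fun v _ y => LinearMap.pi fun j => (line j.1 (toyIndex.over v) (y j)) • LinearMap.proj j
  Mmod := fun _ => Set.univ

/-- **(c)'s global realified Frobenioids in the value chart**: objects `q^a·𝒪` (`a ∈ ℚ`), degree `−a·log p`, region `H_a`.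
[claim: Mochizuki2012, status: disputed] -/
def vDegrees (j : toyIndex.LabelStar) : GlobalDegrees (valShells p) j where
  ObjMOD := ℚ
  Objmod := ℚ
  natIso := Equiv.refl ℚ
  deg := fun a => -(a : ℝ) * Real.log p
  region := fun a vQ => vHalf p j.1 vQ a

/-- **The value-chart situation**: value-chart shells, `vData` on every vertical line (an `abbrev`). [claim: Mochizuki2012, status: disputed] -/
abbrev vSituation : Situation toyIndex where
  L := valShells p
  D := fun _ => vData p
  G := fun _ j => vDegrees p j

/-- **The column** ([IUTchIII] Thm. 3.11 (ii)): Kummer transport the identity at every `(n, m)` (valuations carry no sign to twist),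
unit-group images `H_{m'+1}`, Frobenioid objects tagged copies of `ℤ`, Θ-pilot the object of index `1` (as abc-iut-w5-d247's `naiveColumn`).
[claim: Mochizuki2012, status: disputed] -/
def vColumn : Column (valShells p) where
  frobAdm := fun _ j vQ A => ∃ a : ℚ, A = vHalf p j vQ a
  frobLogvol := fun _ j vQ A => vVol p j vQ A
  frobΨ := fun _ v _ => vPsi p v
  frobMmod := fun _ _ => Set.univ
  unitImage := fun _ m' j vQ => vHalf p j vQ ((m' : ℚ) + 1)
  ballImage := fun _ j vQ => vHalf p j vQ 0
  ObjLGP := ℤ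
  frobObjLGP := FrobObj
  kumLGP := kum
  ObjLgp := ℤ
  frobObjLgp := FrobObj
  kumLgp := kum
  thetaPilot := fun m => ⟨(1, m), rfl⟩

/-- **The full situation of [IUTchIII] Thm. 3.11 in the value chart** (link data: abc-iut-w5-d247's `naiveLink`). An `abbrev`.
[claim: Mochizuki2012, status: disputed] -/
abbrev vFull : FullSituation toyIndex where
  toSituation := vSituation p
  col := fun _ => vColumn p
  link := naiveLink

/-- **The typed [IUTchIII] Theorem 3.11 (i) ∧ (ii) ∧ (iii) HOLDS in the value chart** (template: w4-d098's `sFull_statement`; (ii) is trivial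
for the identity transport, (Ind3) is `H_{m'+1} ⊆ H_0`). [folklore] -/
theorem vFull_statement : (vFull p).Statement := by
  have hI : (vFull p).PartI := by
    refine ⟨fun n v hv x _ j => ?_, fun n j a => ⟨fun vQ => ⟨a, rfl⟩, Set.toFinite _, ?_⟩, fun _ _ => rfl⟩
    · show x j ∈ signShells.SubPacket j.1 v
      rw [subPacket_eq_top]; trivial
    · rw [finsum_unique]
      exact (vVol_vHalf p j.1 _ a).symm
  refine ⟨hI, fun n => ?_, ?_⟩
  · refine (Column.partII_iff _ _).2 ⟨fun m j vQ A hA => ⟨hA, rfl⟩, fun m v hv => rfl, fun m j => rfl, ?_⟩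
    refine ⟨fun m m' j vQ _ => vHalf_anti p (by positivity), fun m j vQ h => absurd trivial h⟩
  · refine ⟨naiveLink.partIIIa_holds, naiveLink.partIIIb_holds, ?_, ?_,
      (vFull p).evalCompatUpToInd_of_multiradialCompat hI.2.2⟩
    · refine naiveLink.partIIIc_of_full (fun _ => rfl) fun n m => ?_
      rintro _ ⟨a, rfl⟩
      show unitIso a ≪≫ unitIso ((-1) ^ m.natAbs) = unitIso ((-1) ^ m.natAbs) ≪≫ unitIso a
      rw [unitIso_trans, unitIso_trans, mul_comm]
    · intro n m; exact Thm311.PolyIsoCalc.stabilized_full _ _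

/-- Thm. 3.11 (ii) (b) for every column of the value chart. [folklore] -/
theorem val_kummerB (n : ℤ) : ((vFull p).col n).KummerB ((vFull p).D n) := fun _ _ _ => rfl

/-! ## 3. The hull frame and the setting -/

/-- **The hull frame**: hull-sets the half-lines; «relatively compact» = bounded below; «admits a hull» = a LEAST half-line containing the set
exists (the infimum is attained in `ℚ`). [claim: Mochizuki2012, status: disputed] -/
def vFrame (j : toyIndex.Label) (vQ : toyIndex.VQ) : HullFrame ((valShells p).Packet j vQ) where
  Hul := {H | ∃ a : ℚ, H = vHalf p j vQ a}
  IsBounded := fun U => ∃ a : ℚ, U ⊆ vHalf p j vQ a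
  HasHull := fun U => ∃ a : ℚ, U ⊆ vHalf p j vQ a ∧ ∀ b : ℚ, U ⊆ vHalf p j vQ b → b ≤ a
  hul_bounded := by rintro _ ⟨a, rfl⟩; exact ⟨a, subset_rfl⟩
  bounded_mono := fun U U' hUU' ⟨a, ha⟩ => ⟨a, hUU'.trans ha⟩
  exists_hul := fun U ⟨a, ha⟩ => ⟨vHalf p j vQ a, ⟨a, rfl⟩, ha⟩
  hull_mem := by
    rintro U - ⟨a, hUa, hmax⟩
    refine ⟨a, Set.Subset.antisymm ?_ ?_⟩
    · exact Set.sInter_subset_of_mem ⟨⟨a, rfl⟩, hUa⟩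
    · refine Set.subset_sInter ?_
      rintro H ⟨⟨b, rfl⟩, hUb⟩
      exact vHalf_anti p (hmax b hUb)

/-- **The setting of the value chart**: abc-iut-w4-d101's honest object side `pinSig` (pilots of exponent `1`) over the value-chart
situation, with HONEST glue — the `(n,m)`-Kummer image of the lgp-object of exponent `k` at label `j` is `H_{k·j²}` (so `H_0` at the junk
label), the image of the `△`-object of exponent `k` is `H_k` on `𝔽_l^⋇` and `H_0` at the junk label. [claim: Mochizuki2012, status: disputed] -/
def valSetting : Setting (vSituation p) where
  n := 0
  HT := ℤ × ℤ
  LogLink := fun _ _ => Unit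
  IsFull := fun _ => True
  lattice :=
    { theater := fun n m => (n, m)
      distinct := fun p q h => by simpa using h
      logLink := fun _ _ => ()
      logLink_full := fun _ _ => trivial }
  Frd := Unit
  IsoF := fun _ _ => Unit
  Ob := fun _ => ℤ
  realify := id
  Strip := Unit
  IsoS := fun _ _ => Unit
  M := fun _ _ => ExpMonoid
  sig := pinSig
  split := { Msplit := fun _ _ => ⊤, exists_gen := fun _ _ => ⟨⟨gen, trivial⟩, top_gen_isGenerator⟩ }
  ObΔ := ℤ
  N := fun _ _ => ExpMonoid
  qData :=
    { q := fun _ _ => gen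
      q_gen := fun _ _ => gen_isGenerator
      objOf := fun x => (expOf (x () (Set.mem_univ ())) : ℤ) }
  frame := fun j vQ => vFrame p j vQ
  hul_adm := fun _ _ _ hH => hH
  thetaRegionOf := fun _ k j vQ => vHalf p j vQ ((k : ℚ) * (jsq j : ℚ))
  qRegionOf := fun k j vQ => vHalf p j vQ (if j = 0 then 0 else (k : ℚ))
  qRegion_mem := fun _ _ => ⟨_, rfl⟩
  qSupport_finite := fun _ => Set.toFinite _

/-- The Θ-pilot object is the lgp-object of exponent `1`. [folklore] -/
theorem valSetting_thetaPilot : (valSetting p).thetaPilot = (1 : ℤ) :=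
  congrArg (Nat.cast : ℕ → ℤ)
    (expOf_eq_one_of_isGenerator_top (Classical.choose_spec ((valSetting p).split.exists_gen () (Set.mem_univ ()))))

/-- The q-pilot object is the `△`-object of exponent `1`. [folklore] -/
theorem valSetting_qPilot : (valSetting p).qPilot = (1 : ℤ) := rfl

/-- `jsq 0 = 0` in `ℚ`: at the junk label the honest glue gives the unit shell `H_0`. [folklore] -/
theorem jsq_zero_cast : ((jsq (0 : toyIndex.Label) : ℤ) : ℚ) = 0 := by
  unfold jsq; norm_num

/-- The `(n,m)`-Kummer image of the Θ-pilot at label `j` is the honest `H_{j²}` (`H_0` at the junk label). [folklore] -/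
theorem valSetting_thetaRegion (m : ℤ) (j : toyIndex.Label) (vQ : toyIndex.VQ) :
    (valSetting p).thetaRegion m j vQ = vHalf p j vQ (jsq j : ℚ) := by
  unfold Setting.thetaRegion
  rw [valSetting_thetaPilot]
  show vHalf p j vQ (((1 : ℤ) : ℚ) * (jsq j : ℚ)) = _
  rw [Int.cast_one, one_mul]

/-- The q-pilot image at label `j`: the honest `H_1` (the chart of `q·𝒪`) on `𝔽_l^⋇`, `H_0` at the junk label. [folklore] -/
theorem valSetting_qRegion (j : toyIndex.Label) (vQ : toyIndex.VQ) :
    (valSetting p).qRegion j vQ = vHalf p j vQ (if j = 0 then 0 else 1) := by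
  show vHalf p j vQ (if j = 0 then 0 else ((1 : ℤ) : ℚ)) = _
  rw [Int.cast_one]

/-- The (Ind3)-enlarged region at label `j` is `H_{j²}`. [folklore] -/
theorem valSetting_thetaRegion3 (j : toyIndex.Label) (vQ : toyIndex.VQ) :
    (valSetting p).thetaRegion3 j vQ = vHalf p j vQ (jsq j : ℚ) := by
  show (⋃ m : ℤ, (valSetting p).thetaRegion m j vQ) = _
  simp_rw [valSetting_thetaRegion]
  exact Set.iUnion_const _

/-! ## 4. The region reading and the pins -/

/-- **The region reading of the value chart** «`X ↦ {v ≥ X_j}`»: at `j ∈ 𝔽_l^⋇` the half-line above the `j`-components of the tuples of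
`X` (the chart of w4-d101's `Ψ ↦ Ψ_j·𝒪`), at the junk label the unit shell `H_0` (scale-invariant, as (hρ) demands there).
[claim: Mochizuki2012, status: disputed] -/
def vRho (X : ∀ v : toyIndex.V, v ∈ toyIndex.Vbad → Set ((valShells p).StarPacket v)) (j : toyIndex.Label) (vQ : toyIndex.VQ) :
    Set ((valShells p).Packet j vQ) :=
  if h : j = 0 then vHalf p j vQ 0 else {x | ∃ ψ ∈ X vQ (Set.mem_univ _), line j vQ (ψ ⟨j, h⟩) ≤ line j vQ x}

/-- **(hρ): `vRho` is equivariant under the WHOLE group `⟨(Ind1) ∪ (Ind2)⟩` of the value-chart shells** — every element acts on each packet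
line by a POSITIVE scalar (w4-d098's `actsByScalars_of_mem_closure`), which transports `{v ≥ X_j}` and fixes `H_0`. [folklore] -/
theorem vRho_equivariant {Φ : (valShells p).PacketAut}
    (hΦ : Φ ∈ Subgroup.closure ((valShells p).Ind1Family ∪ (valShells p).Ind2Family))
    (X : ∀ v : toyIndex.V, v ∈ toyIndex.Vbad → Set ((valShells p).StarPacket v)) (j : toyIndex.Label) (vQ : toyIndex.VQ) :
    vRho p (fun v hv => (valShells p).starAut Φ v '' X v hv) j vQ = Φ j vQ '' vRho p X j vQ := by
  obtain ⟨u, hu, hΦc⟩ := (ScalarShells.actsByScalars_of_mem_closure hΦ).scalar j vQ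
  have hu0 : (0 : ℚ) < u := (Units.mem_posSubgroup _).1 hu
  unfold vRho
  split_ifs with h
  · rw [image_vHalf_of_line_eq p (Φ j vQ) hu0 hΦc, mul_zero]
  · have h2 : ∀ ψ : (valShells p).StarPacket vQ,
        line j vQ ((valShells p).starAut Φ vQ ψ ⟨j, h⟩) = (u : ℚ) * line j vQ (ψ ⟨j, h⟩) := fun ψ => hΦc _
    ext x
    constructor
    · rintro ⟨_, ⟨ψ, hψ, rfl⟩, hx⟩
      refine ⟨(Φ j vQ).symm x, ⟨ψ, hψ, ?_⟩, LinearEquiv.apply_symm_apply _ _⟩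
      have h1 := hΦc ((Φ j vQ).symm x)
      rw [LinearEquiv.apply_symm_apply] at h1
      rw [h2, h1] at hx
      exact le_of_mul_le_mul_left hx hu0
    · rintro ⟨y, ⟨ψ, hψ, hy⟩, rfl⟩
      refine ⟨(valShells p).starAut Φ vQ ψ, ⟨ψ, hψ, rfl⟩, ?_⟩
      rw [hΦc, h2]
      exact mul_le_mul_of_nonneg_left hy hu0.le

/-- `vRho` on a tuple set all of whose `j`-components have coordinate `c`, and which has an element: the half-line `H_c`. [folklore] -/
theorem vRho_eq_vHalf {j : toyIndex.Label} (hj : j ≠ 0) (vQ : toyIndex.VQ)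
    (X : ∀ v : toyIndex.V, v ∈ toyIndex.Vbad → Set ((valShells p).StarPacket v)) (c : ℚ)
    (hX : ∀ ψ ∈ X vQ (Set.mem_univ _), line j vQ (ψ ⟨j, hj⟩) = c) {ψ₀ : (valShells p).StarPacket vQ}
    (hψ₀ : ψ₀ ∈ X vQ (Set.mem_univ _)) : vRho p X j vQ = vHalf p j vQ c := by
  unfold vRho
  rw [dif_neg hj]
  ext x
  constructor
  · rintro ⟨ψ, hψ, hx⟩
    rw [mem_vHalf, ← hX ψ hψ]
    exact hx
  · intro hx
    exact ⟨ψ₀, hψ₀, by rw [hX ψ₀ hψ₀]; exact hx⟩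

/-- `vRho` on the Θ-tuple datum: the honest `H_{j²}` at every label (`H_0` at the junk label). [folklore] -/
theorem vRho_vPsi (j : toyIndex.Label) (vQ : toyIndex.VQ) : vRho p (fun v _ => vPsi p v) j vQ = vHalf p j vQ (jsq j : ℚ) := by
  by_cases h : j = 0
  · subst h; unfold vRho; rw [dif_pos rfl, jsq_zero_cast]
  · exact vRho_eq_vHalf p h vQ _ _ (fun ψ hψ => hψ ⟨j, h⟩) (thetaTuple_mem p vQ)

/-- `vRho` on the q-pilot's Kummer datum: the honest `H_1` on `𝔽_l^⋇`, `H_0` at the junk label. [folklore] -/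
theorem vRho_vQDatum (j : toyIndex.Label) (vQ : toyIndex.VQ) :
    vRho p (vQDatum p) j vQ = vHalf p j vQ (if j = 0 then 0 else 1) := by
  by_cases h : j = 0
  · subst h; unfold vRho; rw [dif_pos rfl, if_pos rfl]
  · rw [if_neg h]; exact vRho_eq_vHalf p h vQ _ _ (fun ψ hψ => hψ ⟨j, h⟩) (qTuple_mem p vQ)

/-- **(hρ) ∧ (pΘ) — the Θ-pilot pin HOLDS** in the value chart. [claim: Mochizuki2012, status: disputed] -/
theorem val_thetaPinned : ThetaPinned (vFull p).toLatticeSituation (valSetting p) (vRho p) := by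
  refine ⟨fun Φ hΦ X j vQ => vRho_equivariant p hΦ X j vQ, fun m j vQ => ?_⟩
  show (valSetting p).thetaRegion m j vQ = vRho p (fun v _ => vPsi p v) j vQ
  rw [vRho_vPsi, valSetting_thetaRegion]

/-- **(pq′) — the q-pilot pin HOLDS** for the honest Kummer datum `vQDatum`. [claim: Mochizuki2012, status: disputed] -/
theorem val_qPinned : QPinned (vFull p).toLatticeSituation (valSetting p) (vRho p) (vQDatum p) := fun j vQ => by
  rw [valSetting_qRegion, vRho_vQDatum]

/-- **(pL) — the link pin HOLDS** (identity of exponents, pilots of exponent `1`). [folklore] -/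
theorem val_linkPinned : LinkPinned (vFull p).toLatticeSituation (valSetting p) :=
  ⟨Equiv.refl ℤ, by rw [valSetting_thetaPilot, valSetting_qPilot]; rfl⟩

/-- **`PinnedRegions3` HOLDS in the value chart.** [claim: Mochizuki2012, status: disputed] -/
theorem val_pinnedRegions3 : PinnedRegions3 (vFull p).toLatticeSituation (valSetting p) (vRho p) (vQDatum p) :=
  ⟨⟨val_thetaPinned p, val_qPinned p⟩, val_linkPinned p⟩

end Summit.ABC.IUTFork.Repair.CandJoshi23

end
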